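import Literature.NumberTheory.Automorphic.Liu2021.AppendixC.Glue
import Literature.AlgebraicGeometry.Motives.VarietiesGeometricallyIntegralProofs
import HarnessLib

/-!
# Liu 2021, Def. 2.1 (1): for `X` smooth over a field, `∇X` is reduced and locally of finite type

[Liu2021] = Yifeng Liu, *Fourier–Jacobi cycles and arithmetic relative trace formula*, Camb. J. Math. **9** (2021) = arXiv:2102.11518,
§2.1 Def. 2.1 (1) (FJcycle.tex l. 1174): «We denote by `∇X` the smallest open and closed subscheme of `X × X` containing the diagonal `ΔX`»
(carrier `AppendixC.Nabla X`, `AppendixC/Glue.lean`); standing hypothesis of §2.1: «`X` … proper smooth» (l. 1191).  PROOF FILE (theorems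
only): `∇X ↪ X × X` is an open immersion and `X × X → Spec k` is smooth, so `∇X` is REDUCED ([StacksProject] 056T: smooth over a field ⇒
reduced; tree `isReduced_of_smooth_over_field`) and LOCALLY OF FINITE TYPE over `k` — the two instance hypotheses under which geometric
points of `∇X` separate morphisms (`AlbaneseMapEpi.lean`: `Albanese.epi_map_of_nablaMap_surjective_algPoints`,
`Sec42Data.epi_Atr_of_nablaTr_surjective_algPoints`); for the §4.2 datum, `X_K` is smooth (`CompactifiedSystem.smooth_X`).
No definition, no named fact, no `sorry`.  HC_CM is NOT proved.
-/

set_option autoImplicit false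

noncomputable section

open CategoryTheory CategoryTheory.Limits AlgebraicGeometry MonoidalCategory CartesianMonoidalCategory

namespace Literature.NumberTheory.Automorphic.Liu2021.AppendixC

open Literature.AlgebraicGeometry.Motives

set_option backward.isDefEq.respectTransparency false

variable {k : Type} [Field k] {d : ℕ} {X : SchemeOver k}

/-- `X × X → Spec k` is smooth (of relative dimension `d + d`) for `X → Spec k` smooth of relative dimension `d` (base change and
composition). [folklore] -/
private theorem smooth_tensorObj_hom [SmoothOfRelativeDimension d X.hom] : Smooth (X ⊗ X).hom := by
  haveI := smoothOfRelativeDimension_isStableUnderBaseChange (n := d)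
  haveI : SmoothOfRelativeDimension d (pullback.fst X.hom X.hom) :=
    MorphismProperty.pullback_fst _ _ ‹_›
  haveI : SmoothOfRelativeDimension (d + d) (X ⊗ X).hom := by
    rw [Over.tensorObj_hom]; infer_instance
  exact SmoothOfRelativeDimension.smooth (d + d) _

namespace Nabla

/-- **`∇X` is reduced for `X` smooth over `k`** (an open subscheme of the smooth, hence reduced, `X × X`).
[cite: StacksProject, Tag 056T (Varieties, Lemma 33.25.4)] [cite: Liu2021, Def. 2.1 (1), l. 1171–1174] -/
theorem isReduced_left [SmoothOfRelativeDimension d X.hom] (N : Nabla X) : IsReduced N.N.left := by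
  haveI := N.isOpenImmersion_incl
  haveI : Smooth (X ⊗ X).hom := smooth_tensorObj_hom (d := d)
  haveI : IsReduced (X ⊗ X).left := isReduced_of_smooth_over_field (X ⊗ X).hom
  exact isReduced_of_isOpenImmersion N.incl.left

/-- **`∇X → Spec k` is locally of finite type for `X` smooth over `k`** (open immersion into `X × X`, smooth over `k`).
[cite: Liu2021, Def. 2.1 (1), l. 1171–1174] -/
theorem locallyOfFiniteType_hom [SmoothOfRelativeDimension d X.hom] (N : Nabla X) : LocallyOfFiniteType N.N.hom := by
  haveI := N.isOpenImmersion_incl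
  haveI : Smooth (X ⊗ X).hom := smooth_tensorObj_hom (d := d)
  rw [← Over.w N.incl]
  infer_instance

end Nabla

namespace Sec42Data

variable {F E : Type} [Field F] [NumberField F] [NumberField.IsTotallyReal F] [Field E] [NumberField E] [Algebra F E]
  [NumberField.IsTotallyComplex E] [Algebra.IsQuadraticExtension F E]
variable {P5 : PropC5Data F E} {isotropicAt : ℕ → Prop} (C : Sec42Data P5 isotropicAt)

/-- For a §4.2 datum, `∇X_K` is reduced («`{X_K}_K` … smooth projective», §4.2 l. 2064; `CompactifiedSystem.smooth_X`).
[cite: Liu2021, §4.2 l. 2062–2064 and Def. 2.1 (1)] -/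
theorem isReduced_nabla_left (K : C5.SmallLevel C.S.K₀) : IsReduced (C.alb K).nabla.N.left := by
  haveI := C.cpt.smooth_X K
  exact (C.alb K).nabla.isReduced_left (d := P5.n - 1)

/-- For a §4.2 datum, `∇X_K → Spec E` is locally of finite type. [cite: Liu2021, §4.2 l. 2062–2064 and Def. 2.1 (1)] -/
theorem locallyOfFiniteType_nabla_hom (K : C5.SmallLevel C.S.K₀) : LocallyOfFiniteType (C.alb K).nabla.N.hom := by
  haveI := C.cpt.smooth_X K
  exact (C.alb K).nabla.locallyOfFiniteType_hom (d := P5.n - 1)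

end Sec42Data

end Literature.NumberTheory.Automorphic.Liu2021.AppendixC

end
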